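import Summits.QuantumFields.YangMills.Theorems.FluctuationComparisonRegPrIntLLargeFieldGasOfEnginePackage
import Summits.QuantumFields.YangMills.Theorems.FluctuationComparisonRegPrIntLLargeFieldGasEngineOfTwoGas
import Summits.QuantumFields.YangMills.Theorems.FluctuationComparisonRegPrIntLLargeFieldGasBlockAnimals
import HarnessLib

/-!
# LFG^{can}∘ FROM A TWO-GAS PACKAGE (G15, px10 lineage): ★★★ `enginePackage_of_twoGasPackage` ∕ ★★★ `largeFieldFourPtIntCan_of_twoGasPackage` — the ENGINE PACKAGE `hE` of
# ✓`largeFieldFourPtIntCan_of_enginePackage` (FILE 10, RECORD 17fi), hence the REGISTERED `stub_largeFieldFourPtIntCan`, from ONE ∀∃-statement whose rows are Bałaban's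
# ONE-STEP∕MULTI-STEP EXPANSION WITH VACUUM POLYMERS AND HOLES in identity form ([Balaban1985UV3] Thm 2 (43)–(47)) plus its two activity bounds — the ratio, the Mayer step,
# the component resummation (1.90)–(1.91), the activity bookkeeping (1.97) and the block-animal entropy being THEOREMS (✓`engineRows_of_twoGas`, ✓`…BlockAnimals`, lit ✓`B16RatioResummation*`)

Cell `ym3-torus` (HUMAN RULING D-0037: rung R3 = continuum `SU(2)` Yang–Mills on `T³` — NOT `d = 4`, NOT infinite volume, NOT a mass gap, NOT the Clay problem); width seat
`ym3-torus-px10` (gen 18); helper of the crux `stmt-QuantumFields-20520` `UnitScaleTilt.FluctuationComparisonRegPrIntL` (`--supports … --as helper`, NOT a proof of it).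
THEOREMS ONLY: 0 `def`, 0 `instance`, 0 `notation`, 0 `sorry`, default heartbeats.

THE TWO-GAS PACKAGE (hypothesis `h2P`, spelled inline; same prefix as `hE` with the input small-factor constant `a₂`).  For every `L`: a grain `μ`, `a₂ > 0`, a window shrink `c₀`,
per `c` a profile threshold `pS`, per `b₀ > 0`, `p₀ ≥ pS` a coupling ceiling `γE`; for every family `F` with `F.L = L`, `0 < γ ≤ γE`, every `J ≤ K`, under FILE 10's three window
hypotheses: a grain `μ′ ≤ μ`, `μ′ ≤ m + J`; a CATALOGUE `Λ` of non-empty footprints of touching-connected `μ′`-block families; VACUUM activities `v U X` — V-local, continuous on the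
window, Kotecký–Preiss (1) on the window with size `τ·#blocks`, decay `κ′·#blocks`; HOLE activities `h₂ Q′ X U` — V-local, continuous on the window, bounded there by
`(Π_{l∈Q′} sf(a₂) l)·e^{−κ_h·#blocks X}` on deep `Q′`; numeric rows `4 + 2 log 26 ≤ κ′`, `0 < τ`, `κ′ + e^{τ∕κ′}·τ + (2 + 2 log 26) ≤ κ_h`; and THE UNNORMALISED IDENTITY per deep history
`Q`, a.e. on the window: `ρ(E_Q)·Ξ_v(Λ) = ρ(E_∅)·Σ_{S ∈ IsHoleFamily (admOf Q) (located holes of Q)} (Π_{X∈S} h₂ (Q↾X) X U)·Ξ_v(vacCompat Λ S)`.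
* §1 `smallFactor_add`, ★`smallFactor_mul_exp_le_half` — the output small factor: `sf(a₂) i·e ≤ sf(a₂∕2) i` once `log γ⁻¹ ≥ max 1 (8∕(a₂ b₀²))` (`p₀ ≥ 1`, `L > 1`), via ✓`smallFactor_rescale`
  (FILE 10) and ✓`smallFactor_le_exp_neg_sq_mul_coupling` (px10 g16).
* §2 ★★★ `enginePackage_of_twoGasPackage : TWO-GAS PACKAGE → ENGINE PACKAGE` — thread the prefix (`a := a₂∕2`, `pS ↦ max pS 1`, `γE ↦ min γE (min 1 e^{−max 1 (8∕(a₂b₀²))})`), then per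
  `(J, K)`: ✓`engineRows_of_twoGas` at FILE 9's letters BY UNIFICATION (`π l := ⟨siteShift … (blkIter (K − J − l.1) l.2.src), l.2.μ⟩`, `deep l := l.1 < K − J`, `blk b := iterBlockOf μ′ b.src`,
  `IsConn Fc := ((touchingGraph SiteTouch).induce Fc).Connected`, `ρ Q := heightDensity … (histEvent … Q)`, `ρ₀ := heightDensity … histGood`, `W :=` the window) with the two geometric rows
  supplied by ✓`blocks_connected_union` and ✓`sum_exp_neg_blocks_le_one` (`κ_e := 2 + 2 log 26`, `d = 3`); the rows are fed ONE AT A TIME (named holes) and the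
  entropy row through `convert` — LEAN LESSON: a restated `Finset.filter` carries another `Decidable` instance and `exact` then diverges at `whnf`.
* §3 ★★★ `largeFieldFourPtIntCan_of_twoGasPackage := largeFieldFourPtIntCan_of_enginePackage ∘ enginePackage_of_twoGasPackage` — so `stub_largeFieldFourPtIntCan :=
  largeFieldFourPtIntCan_of_twoGasPackage h2P` for any proof `h2P` of the two-gas package.

HONEST — WHAT THIS IS NOT.  The two-gas package IS Bałaban's renormalisation step(s) with holes for the `d = 3` tower — XL, OPEN, NOT proved here or anywhere in the tree; everything
landed is the algebra∕combinatorics AFTER it.  CURRENCY CAVEAT (№229) inherited: V-locality of `v`, `h₂` in `U` vs print's background locality ([Balaban1987RG1] (0.22)–(0.24); BGFORM∘).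
LFG^{can}∘ ∕ `stub_largeFieldFourPtIntCan` ∕ S2β ∕ the crux 20520 NOT proved; `YM3TorusSU2` NOT proved; finite volume ∕ conditional; the Yang–Mills mass gap (Clay) NOT proved; rung R3 =
YM₃ on `T³` — NOT `d = 4`, NOT infinite volume, NOT a mass gap.
References: [Balaban1985UV3] T. Bałaban, CMP 102 (1985): Thm 1 p.257, (7) p.257, (43)–(47) pp.266–267, (67)–(71) pp.273–274; [Balaban1989LargeFieldII] CMP 122 (1989): (1.72) p.379,
(1.84) p.386, (1.90)–(1.91) p.388, (1.97)–(1.101) pp.389–390; [KoteckyPreiss1986] CMP 103 (1986), Theorem p.492 (1), (4), (5).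
-/

set_option autoImplicit false

noncomputable section

open Finset MeasureTheory Filter Topology Set
open scoped BigOperators
open Literature.Probability.LatticeModels
open Literature.MathematicalPhysics.QuantumFieldTheory.Balaban1983to89
open Literature.MathematicalPhysics.QuantumFieldTheory.Balaban1983to89.T3ContinuumYM3Torus
open Literature.MathematicalPhysics.QuantumFieldTheory.Balaban1983to89.T3NestedUnitLaws
open Literature.MathematicalPhysics.QuantumFieldTheory.Balaban1983to89.T3UnitLawDensityEML
open Literature.MathematicalPhysics.QuantumFieldTheory.Balaban1983to89.T3UnitScaleTilt
open Literature.MathematicalPhysics.QuantumFieldTheory.Balaban1983to89.T3TiltDescent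
open Literature.MathematicalPhysics.QuantumFieldTheory.Balaban1983to89.T3PrintedRegularMinimiser
open Literature.MathematicalPhysics.QuantumFieldTheory.Balaban1983to89.T3LevelShift
open Literature.MathematicalPhysics.QuantumFieldTheory.Balaban1983to89.Missing
open Literature.MathematicalPhysics.QuantumFieldTheory.Balaban1983to89.T4Continuum
open scoped Literature.MathematicalPhysics.QuantumFieldTheory.Balaban1983to89.T3OrbitAverage
open Literature.MathematicalPhysics.QuantumFieldTheory.Balaban1983to89.Node00 (touchingGraph SiteTouch)
open Literature.MathematicalPhysics.QuantumFieldTheory.Balaban1983to89.B5Eq118OneStroke (iterBlockOf)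
open Literature.MathematicalPhysics.QuantumFieldTheory.BalabanImbrieJaffe1984to88.BIJ85BlockAveragesTorusK (blkIter)
open Literature.MathematicalPhysics.QuantumFieldTheory.Balaban1983to89.B16RatioResummation (IsHoleFamily vacCompat)
open Summit.QuantumFields.YangMills.Theorems.FluctuationComparisonRegPrIntLWregGlue (heightDensityCan)
open Summit.QuantumFields.YangMills.Theorems.FluctuationComparisonRegPrIntLHistoryPartition (LFLabel histEvent smallFactor smallFactor_pos)
open Summit.QuantumFields.YangMills.Theorems.FluctuationComparisonRegPrIntLLargeFieldGasOfEnginePackage (smallFactor_rescale largeFieldFourPtIntCan_of_enginePackage)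
open Summit.QuantumFields.YangMills.Theorems.FluctuationComparisonRegPrIntLLargeFieldGasBudgetSmall (smallFactor_le_exp_neg_sq_mul_coupling)
open Summit.QuantumFields.YangMills.Theorems.FluctuationComparisonRegPrIntLLargeFieldGasEngineOfTwoGas (engineRows_of_twoGas)
open Summit.QuantumFields.YangMills.Theorems.FluctuationComparisonRegPrIntLLargeFieldGasBlockAnimals (blocks_connected_union sum_exp_neg_blocks_le_one)

namespace Summit.QuantumFields.YangMills.Theorems.FluctuationComparisonRegPrIntLLargeFieldGasOfTwoGasPackage

/-! ## §1 The output small factor -/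

/-- The small factor is multiplicative in its constant: `sf(κ₁ + κ₂) = sf(κ₁)·sf(κ₂)`. [cite: Balaban1985UV3, (7) p.257] -/
theorem smallFactor_add (L : ℕ) (γ b₀ p₀ κ₁ κ₂ : ℝ) (i : ℕ) :
    smallFactor L γ b₀ p₀ (κ₁ + κ₂) i = smallFactor L γ b₀ p₀ κ₁ i * smallFactor L γ b₀ p₀ κ₂ i := by
  unfold smallFactor
  rw [← Real.exp_add]
  ring_nf

/-- ★ **THE OUTPUT SMALL FACTOR**: for `L > 1`, `p₀ ≥ 1`, `0 < γ ≤ 1`, `0 < b₀`, `0 < a₂` and `max 1 (8∕(a₂ b₀²)) ≤ log γ⁻¹`: `sf(a₂) i·e ≤ sf(a₂∕2) i` at every height `i` — one factor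
`sf(a₂∕2) ≤ e^{−(a₂∕2)(log γ⁻¹∕2)²·b₀²} ≤ e^{−1}` pays for the constant. [cite: Balaban1985UV3, (7) p.257 and (67)-(71) pp.273-274] -/
theorem smallFactor_mul_exp_le_half {L : ℕ} (hL : 1 < L) {γ b₀ p₀ a₂ : ℝ} (hγ : 0 < γ) (hγ1 : γ ≤ 1) (hb : 0 < b₀) (hp : 1 ≤ p₀) (ha : 0 < a₂)
    (hlog : max 1 (8 / (a₂ * b₀ ^ 2)) ≤ Real.log γ⁻¹) (i : ℕ) :
    smallFactor L γ b₀ p₀ a₂ i * Real.exp 1 ≤ smallFactor L γ b₀ p₀ (a₂ / 2) i := by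
  have hsplit : smallFactor L γ b₀ p₀ a₂ i = smallFactor L γ b₀ p₀ (a₂ / 2) i * smallFactor L γ b₀ p₀ (a₂ / 2) i := by
    rw [← smallFactor_add]; ring_nf
  have hhalf : smallFactor L γ b₀ p₀ (a₂ / 2) i ≤ Real.exp (-1) := by
    rw [smallFactor_rescale]
    have hκ : 0 ≤ a₂ / 2 * b₀ ^ 2 := by positivity
    refine (smallFactor_le_exp_neg_sq_mul_coupling hL hγ hγ1 le_rfl hp hκ i).trans ?_
    have h1 : Real.exp (-(a₂ / 2 * b₀ ^ 2 * ((Real.log L / 2) ^ 2 * (i : ℝ) ^ 2))) ≤ 1 := by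
      rw [Real.exp_le_one_iff]
      have : 0 ≤ a₂ / 2 * b₀ ^ 2 * ((Real.log L / 2) ^ 2 * (i : ℝ) ^ 2) := by positivity
      linarith
    have h2 : Real.exp (-(a₂ / 2 * b₀ ^ 2 * (Real.log γ⁻¹ / 2) ^ 2)) ≤ Real.exp (-1) := by
      rw [Real.exp_le_exp]
      have hT1 : 1 ≤ Real.log γ⁻¹ := (le_max_left _ _).trans hlog
      have hT2 : 8 / (a₂ * b₀ ^ 2) ≤ Real.log γ⁻¹ := (le_max_right _ _).trans hlog
      have hsq : 8 / (a₂ * b₀ ^ 2) ≤ Real.log γ⁻¹ ^ 2 := by nlinarith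
      have hab : 0 < a₂ * b₀ ^ 2 := by positivity
      have h8 : 8 ≤ a₂ * b₀ ^ 2 * Real.log γ⁻¹ ^ 2 := by
        have := mul_le_mul_of_nonneg_left hsq hab.le
        rwa [mul_div_cancel₀ _ hab.ne'] at this
      nlinarith
    calc Real.exp (-(a₂ / 2 * b₀ ^ 2 * ((Real.log L / 2) ^ 2 * (i : ℝ) ^ 2))) * Real.exp (-(a₂ / 2 * b₀ ^ 2 * (Real.log γ⁻¹ / 2) ^ 2))
        ≤ 1 * Real.exp (-1) := mul_le_mul h1 h2 (Real.exp_nonneg _) zero_le_one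
      _ = Real.exp (-1) := one_mul _
  have h0 : 0 ≤ smallFactor L γ b₀ p₀ (a₂ / 2) i := (smallFactor_pos _ _ _ _ _ _).le
  calc smallFactor L γ b₀ p₀ a₂ i * Real.exp 1
      = smallFactor L γ b₀ p₀ (a₂ / 2) i * (smallFactor L γ b₀ p₀ (a₂ / 2) i * Real.exp 1) := by rw [hsplit]; ring
    _ ≤ smallFactor L γ b₀ p₀ (a₂ / 2) i * (Real.exp (-1) * Real.exp 1) :=
        mul_le_mul_of_nonneg_left (mul_le_mul_of_nonneg_right hhalf (Real.exp_nonneg _)) h0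
    _ = smallFactor L γ b₀ p₀ (a₂ / 2) i := by rw [← Real.exp_add, neg_add_cancel, Real.exp_zero, mul_one]

/-! ## §2 The engine package from the two-gas package -/

open Classical in
/-- ★★★ **ENGINE PACKAGE ⟸ TWO-GAS PACKAGE.**  The hypothesis `hE` of ✓`canInt_of_enginePackage` ∕ ✓`largeFieldFourPtIntCan_of_enginePackage` — Bałaban's expansion with holes
in the vacuum-free, hole-anchored, covering format with its activity rows — follows from the TWO-GAS PACKAGE: the same prefix, and per `(J, K)` a Kotecký–Preiss vacuum gas on
connected block unions, hole activities with one input small factor per deep hole and block decay, and the UNNORMALISED a.e. identity `ρ(E_Q)·Ξ_v(Λ) = ρ(E_∅)·Σ_S (Π h₂)·Ξ_v(vacCompat Λ S)`.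
Output small-factor constant `a := a₂∕2`; the ratio∕Mayer∕resummation∕bounds are ✓`engineRows_of_twoGas`, the two geometric rows ✓`…BlockAnimals`.
[cite: Balaban1985UV3, Thm 1 p.257 and (43)-(47) pp.266-267; Balaban1989LargeFieldII, (1.72) p.379, (1.90)-(1.91) p.388 and (1.97)-(1.101) pp.389-390; KoteckyPreiss1986, Theorem p.492 (1), (4), (5)] -/
theorem enginePackage_of_twoGasPackage
    (h2P : ∀ (L : ℕ), ∃ μ : ℕ, ∃ a₂ : ℝ, 0 < a₂ ∧ ∃ c₀ : ℝ, 0 < c₀ ∧ c₀ ≤ 1 ∧ ∀ (c : ℝ), 0 < c → c ≤ c₀ → ∃ pS : ℝ, ∀ (b₀ p₀ : ℝ), 0 < b₀ → pS ≤ p₀ → 0 < p₀ →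
      ∃ γE : ℝ, 0 < γE ∧ ∀ (F : T3Family) (γ : ℝ), F.L = L → 0 < γ → γ ≤ γE →
        ∀ (J K : ℕ) (hJK : J ≤ K),
          {U : GaugeField (F.P J) 0 (Matrix.specialUnitaryGroup (Fin 2) ℂ) | PlaqSmall (θBal F.L γ (c * b₀) p₀ J) U} ⊆
            Node00.regSet (fieldMeasure (F.P J) 0 (Matrix.specialUnitaryGroup (Fin 2) ℂ)) (heightDensity F γ hJK Set.univ) →
          (∀ U : GaugeField (F.P J) 0 (Matrix.specialUnitaryGroup (Fin 2) ℂ), PlaqSmall (θBal F.L γ (c * b₀) p₀ J) U →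
              0 < heightDensityCan F γ hJK Set.univ U) →
          (∀ U : GaugeField (F.P J) 0 (Matrix.specialUnitaryGroup (Fin 2) ℂ), PlaqSmall (θBal F.L γ (c * b₀) p₀ J) U →
              0 < heightDensityCan F γ hJK (histGood F ℰp (θBal F.L γ b₀ p₀) K J) U) →
          -- ═══ the two-gas expansion at `(J, K)`: a grain, a vacuum gas, hole activities, and the UNNORMALISED identity ═══
          ∃ μ' : ℕ, μ' ≤ μ ∧ μ' ≤ F.m + J ∧
          ∃ (Λ : Finset (Finset (PBond (F.P J) 0))) (v : GaugeField (F.P J) 0 (Matrix.specialUnitaryGroup (Fin 2) ℂ) → Finset (PBond (F.P J) 0) → ℝ)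
            (h₂ : Finset (LFLabel F K J) → Finset (PBond (F.P J) 0) → GaugeField (F.P J) 0 (Matrix.specialUnitaryGroup (Fin 2) ℂ) → ℝ) (τ κ' κh : ℝ),
            -- the vacuum catalogue: non-empty footprints of touching-connected families of `μ′`-blocks
            (∀ X ∈ Λ, X.Nonempty ∧ ∃ Fc : Finset (Site (F.P J) μ'), ((touchingGraph (SiteTouch (P := F.P J) (j := μ'))).induce (Fc : Set (Site (F.P J) μ'))).Connected ∧
              Fc.biUnion (fun y => Finset.univ.filter (fun b : PBond (F.P J) 0 => iterBlockOf μ' b.src = y)) = X) ∧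
            -- vacuum activities: V-local, continuous on the window, Kotecký–Preiss (1) with size `τ·#blocks` and decay `κ′·#blocks`
            (∀ (X : Finset (PBond (F.P J) 0)) (U U' : GaugeField (F.P J) 0 (Matrix.specialUnitaryGroup (Fin 2) ℂ)), (∀ e ∈ X, U e = U' e) → v U X = v U' X) ∧
            (∀ X : Finset (PBond (F.P J) 0), ContinuousOn (fun U => v U X) {U : GaugeField (F.P J) 0 (Matrix.specialUnitaryGroup (Fin 2) ℂ) | PlaqSmall (θBal F.L γ (c * b₀) p₀ J) U}) ∧
            (∀ U ∈ {U : GaugeField (F.P J) 0 (Matrix.specialUnitaryGroup (Fin 2) ℂ) | PlaqSmall (θBal F.L γ (c * b₀) p₀ J) U},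
              ∀ σ : Finset (PBond (F.P J) 0), ∑ γ' ∈ Finset.univ.filter (fun γ' : Finset (PBond (F.P J) 0) => polyInc γ' σ),
                |v U γ'| * Real.exp (τ * (((γ'.image (fun b : PBond (F.P J) 0 => iterBlockOf μ' b.src)).card : ℕ) : ℝ) +
                  κ' * (((γ'.image (fun b : PBond (F.P J) 0 => iterBlockOf μ' b.src)).card : ℕ) : ℝ)) ≤
                τ * (((σ.image (fun b : PBond (F.P J) 0 => iterBlockOf μ' b.src)).card : ℕ) : ℝ)) ∧
            -- hole activities: V-local, continuous on the window, one small factor per deep hole and block decay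
            (∀ (Q' : Finset (LFLabel F K J)) (X : Finset (PBond (F.P J) 0)) (U U' : GaugeField (F.P J) 0 (Matrix.specialUnitaryGroup (Fin 2) ℂ)),
              (∀ e ∈ X, U e = U' e) → h₂ Q' X U = h₂ Q' X U') ∧
            (∀ (Q' : Finset (LFLabel F K J)) (X : Finset (PBond (F.P J) 0)), ContinuousOn (fun U => h₂ Q' X U) {U : GaugeField (F.P J) 0 (Matrix.specialUnitaryGroup (Fin 2) ℂ) | PlaqSmall (θBal F.L γ (c * b₀) p₀ J) U}) ∧
            (∀ (Q' : Finset (LFLabel F K J)) (X : Finset (PBond (F.P J) 0)) (U : GaugeField (F.P J) 0 (Matrix.specialUnitaryGroup (Fin 2) ℂ)), U ∈ {U : GaugeField (F.P J) 0 (Matrix.specialUnitaryGroup (Fin 2) ℂ) | PlaqSmall (θBal F.L γ (c * b₀) p₀ J) U} →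
              (∀ l ∈ Q', l.1.val < K - J) →
              |h₂ Q' X U| ≤ (∏ l ∈ Q', (if l.1.val < K - J then smallFactor F.L γ b₀ p₀ a₂ (K - l.1.val) else 0)) *
                Real.exp (-(κh * (((X.image (fun b : PBond (F.P J) 0 => iterBlockOf μ' b.src)).card : ℕ) : ℝ)))) ∧
            -- numeric rows: tree decay per block beats the entropy of block animals; the hole decay pays for the attached clusters
            4 + 2 * Real.log 26 ≤ κ' ∧ 0 < τ ∧ κ' + Real.exp (τ / κ') * τ + (2 + 2 * Real.log 26) ≤ κh ∧
            -- THE UNNORMALISED IDENTITY per deep history, a.e. on the window: `ρ(E_Q)·Ξ_v(Λ) = ρ(E_∅)·Σ_S (Π h₂)·Ξ_v(vacCompat Λ S)`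
            (∀ Q : Finset (LFLabel F K J), (∀ l ∈ Q, l.1.val < K - J) →
              ∀ᵐ U ∂fieldMeasure (F.P J) 0 (Matrix.specialUnitaryGroup (Fin 2) ℂ), U ∈ {U : GaugeField (F.P J) 0 (Matrix.specialUnitaryGroup (Fin 2) ℂ) | PlaqSmall (θBal F.L γ (c * b₀) p₀ J) U} →
                (heightDensity F γ hJK (histEvent F (θBal F.L γ b₀ p₀) K J Q) U : ℂ) *
                    polymerPartitionFunction polyInc (fun X => ((v U X : ℝ) : ℂ)) Λ =
                  (heightDensity F γ hJK (histGood F ℰp (θBal F.L γ b₀ p₀) K J) U : ℂ) *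
                    ∑ S ∈ (Finset.univ : Finset (Finset (PBond (F.P J) 0))).powerset.filter
                        (IsHoleFamily (fun X => (∃ l ∈ Q, (⟨siteShift (F.sitesPerDir_eq (m := F.m) (K := K) (j := l.1.val + (K - J - l.1.val)) (m' := F.m) (K' := J) (j' := 0)
              (by have := l.1.isLt; omega)) (blkIter (K - J - l.1.val) l.2.src), l.2.μ⟩ : PBond (F.P J) 0) ∈ X) ∧
                          ∃ Fc : Finset (Site (F.P J) μ'), ((touchingGraph (SiteTouch (P := F.P J) (j := μ'))).induce (Fc : Set (Site (F.P J) μ'))).Connected ∧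
                            Fc.biUnion (fun y => Finset.univ.filter (fun b : PBond (F.P J) 0 => iterBlockOf μ' b.src = y)) = X)
                          (Q.image fun l => (⟨siteShift (F.sitesPerDir_eq (m := F.m) (K := K) (j := l.1.val + (K - J - l.1.val)) (m' := F.m) (K' := J) (j' := 0)
              (by have := l.1.isLt; omega)) (blkIter (K - J - l.1.val) l.2.src), l.2.μ⟩ : PBond (F.P J) 0))),
                      (∏ X ∈ S, ((h₂ (Q.filter fun l => (⟨siteShift (F.sitesPerDir_eq (m := F.m) (K := K) (j := l.1.val + (K - J - l.1.val)) (m' := F.m) (K' := J) (j' := 0)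
              (by have := l.1.isLt; omega)) (blkIter (K - J - l.1.val) l.2.src), l.2.μ⟩ : PBond (F.P J) 0) ∈ X) X U : ℝ) : ℂ)) *
                        polymerPartitionFunction polyInc (fun X => ((v U X : ℝ) : ℂ)) (vacCompat Λ S))) :
    ∀ (L : ℕ), ∃ μ : ℕ, ∃ a : ℝ, 0 < a ∧ ∃ c₀ : ℝ, 0 < c₀ ∧ c₀ ≤ 1 ∧ ∀ (c : ℝ), 0 < c → c ≤ c₀ → ∃ pS : ℝ, ∀ (b₀ p₀ : ℝ), 0 < b₀ → pS ≤ p₀ → 0 < p₀ →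
      ∃ γE : ℝ, 0 < γE ∧ ∀ (F : T3Family) (γ : ℝ), F.L = L → 0 < γ → γ ≤ γE →
        ∀ (J K : ℕ) (hJK : J ≤ K),
          {U : GaugeField (F.P J) 0 (Matrix.specialUnitaryGroup (Fin 2) ℂ) | PlaqSmall (θBal F.L γ (c * b₀) p₀ J) U} ⊆
            Node00.regSet (fieldMeasure (F.P J) 0 (Matrix.specialUnitaryGroup (Fin 2) ℂ)) (heightDensity F γ hJK Set.univ) →
          (∀ U : GaugeField (F.P J) 0 (Matrix.specialUnitaryGroup (Fin 2) ℂ), PlaqSmall (θBal F.L γ (c * b₀) p₀ J) U →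
              0 < heightDensityCan F γ hJK Set.univ U) →
          (∀ U : GaugeField (F.P J) 0 (Matrix.specialUnitaryGroup (Fin 2) ℂ), PlaqSmall (θBal F.L γ (c * b₀) p₀ J) U →
              0 < heightDensityCan F γ hJK (histGood F ℰp (θBal F.L γ b₀ p₀) K J) U) →
          -- ═══ the engine's output at `(J, K)`: a grain and Bałaban's expansion with holes ═══
          ∃ μ' : ℕ, μ' ≤ μ ∧ μ' ≤ F.m + J ∧
          ∃ (Adm : Finset (LFLabel F K J) → Finset (PBond (F.P J) 0) → Prop)
            (ζ : Finset (LFLabel F K J) → Finset (PBond (F.P J) 0) → GaugeField (F.P J) 0 (Matrix.specialUnitaryGroup (Fin 2) ℂ) → ℝ)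
            (ζbar : Finset (LFLabel F K J) → Finset (PBond (F.P J) 0) → ℝ) (κmu : ℝ),
            -- footprint map
            (∀ Q' X, Adm Q' X → Q'.Nonempty ∧
              (∀ l ∈ Q', l.1.val < K - J ∧
              (⟨siteShift (F.sitesPerDir_eq (m := F.m) (K := K) (j := l.1.val + (K - J - l.1.val)) (m' := F.m) (K' := J) (j' := 0)
              (by have := l.1.isLt; omega)) (blkIter (K - J - l.1.val) l.2.src), l.2.μ⟩ : PBond (F.P J) 0) ∈ X) ∧
              ∃ Fc : Finset (Site (F.P J) μ'), ((touchingGraph (SiteTouch (P := F.P J) (j := μ'))).induce (Fc : Set (Site (F.P J) μ'))).Connected ∧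
              Fc.biUnion (fun y => Finset.univ.filter (fun b : PBond (F.P J) 0 => iterBlockOf μ' b.src = y)) = X) ∧
            -- the a.e. ratio identity of the expansion with holes, per deep history, on the window
            (∀ Q : Finset (LFLabel F K J), (∀ l ∈ Q, l.1.val < K - J) →
              ∀ᵐ U ∂fieldMeasure (F.P J) 0 (Matrix.specialUnitaryGroup (Fin 2) ℂ), PlaqSmall (θBal F.L γ (c * b₀) p₀ J) U →
              heightDensity F γ hJK (histEvent F (θBal F.L γ b₀ p₀) K J Q) U =
              heightDensity F γ hJK (histGood F ℰp (θBal F.L γ b₀ p₀) K J) U *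
              ∑ 𝒳 ∈ (Finset.univ : Finset (Finset (PBond (F.P J) 0))).powerset.filter (fun 𝒳 => IsCompatible polyInc 𝒳 ∧
              (∀ l ∈ Q, ∃ X ∈ 𝒳, (⟨siteShift (F.sitesPerDir_eq (m := F.m) (K := K) (j := l.1.val + (K - J - l.1.val)) (m' := F.m) (K' := J)
              (j' := 0) (by have := l.1.isLt; omega)) (blkIter (K - J - l.1.val) l.2.src), l.2.μ⟩ : PBond (F.P J) 0) ∈ X) ∧
              ∀ X ∈ 𝒳, Adm (Q.filter fun l => (⟨siteShift (F.sitesPerDir_eq (m := F.m) (K := K) (j := l.1.val + (K - J - l.1.val))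
              (m' := F.m) (K' := J) (j' := 0) (by have := l.1.isLt; omega)) (blkIter (K - J - l.1.val) l.2.src), l.2.μ⟩ : PBond (F.P J) 0) ∈ X) X),
              ∏ X ∈ 𝒳, ζ (Q.filter fun l => (⟨siteShift (F.sitesPerDir_eq (m := F.m) (K := K) (j := l.1.val + (K - J - l.1.val))
              (m' := F.m) (K' := J) (j' := 0) (by have := l.1.isLt; omega)) (blkIter (K - J - l.1.val) l.2.src), l.2.μ⟩ : PBond (F.P J) 0) ∈ X) X U) ∧
            -- continuous, V-local activities with a window-uniform majorant
            (∀ Q' X, Adm Q' X → ContinuousOn (fun U => ζ Q' X U)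
              {U : GaugeField (F.P J) 0 (Matrix.specialUnitaryGroup (Fin 2) ℂ) | PlaqSmall (θBal F.L γ (c * b₀) p₀ J) U}) ∧
            (∀ Q' X (U U' : GaugeField (F.P J) 0 (Matrix.specialUnitaryGroup (Fin 2) ℂ)), Adm Q' X → (∀ e ∈ X, U e = U' e) → ζ Q' X U = ζ Q' X U') ∧
            (∀ Q' X U, Adm Q' X → PlaqSmall (θBal F.L γ (c * b₀) p₀ J) U → |ζ Q' X U| ≤ ζbar Q' X) ∧
            (∀ Q' X, Adm Q' X → 0 ≤ ζbar Q' X) ∧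
            -- the energy bound: one small factor per hole, tree decay per block
            (∀ Q' X, Adm Q' X → ζbar Q' X ≤
              (∏ l ∈ Q', (if l.1.val < K - J then smallFactor F.L γ b₀ p₀ a (K - l.1.val) else 0)) *
              Real.exp (-(κmu * ((X.image (fun b : PBond (F.P J) 0 => iterBlockOf μ' b.src)).card : ℝ)))) ∧
            -- tree decay per block beats the entropy of block animals (a pure number)
            4 + 2 * Real.log 26 ≤ κmu := by
  intro L
  obtain ⟨μ, a₂, ha₂, c₀, hc₀, hc₀1, H⟩ := h2P L
  refine ⟨μ, a₂ / 2, by positivity, c₀, hc₀, hc₀1, fun c hc hcc₀ => ?_⟩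
  obtain ⟨pS, H⟩ := H c hc hcc₀
  refine ⟨max pS 1, fun b₀ p₀ hb hpS hp => ?_⟩
  have hp1 : 1 ≤ p₀ := (le_max_right pS 1).trans hpS
  obtain ⟨γE, hγE, H⟩ := H b₀ p₀ hb ((le_max_left pS 1).trans hpS) hp
  -- the coupling ceiling below which `sf(a₂)·e ≤ sf(a₂∕2)`
  set T : ℝ := max 1 (8 / (a₂ * b₀ ^ 2)) with hT
  refine ⟨min γE (min 1 (Real.exp (-T))), lt_min hγE (lt_min one_pos (Real.exp_pos _)), fun F γ hFL hγ hγle J K hJK hR hP₁ hP₂ => ?_⟩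
  have hγE' : γ ≤ γE := hγle.trans (min_le_left _ _)
  have hγ1 : γ ≤ 1 := hγle.trans ((min_le_right _ _).trans (min_le_left _ _))
  have hγT : γ ≤ Real.exp (-T) := hγle.trans ((min_le_right _ _).trans (min_le_right _ _))
  have hlogγ : T ≤ Real.log γ⁻¹ := by
    rw [Real.log_inv, le_neg, ← Real.exp_le_exp, Real.exp_log hγ]
    exact hγT
  have hL1 : 1 < F.L := hFL ▸ (hFL ▸ F.hL.2 : 1 < F.L)
  obtain ⟨μ', hμ'μ, hμ'J, Λ, v, h₂, τ, κ', κh, hΛ, hvloc, hvc, hKP, hhloc, hhc, hhbd, hκ', hτ, hκh, h2g⟩ := H F γ hFL hγ hγE' J K hJK hR hP₁ hP₂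
  refine ⟨μ', hμ'μ, hμ'J, ?_⟩
  have hd : 0 < (F.P J).d := by rw [T3Family.P_d]; norm_num
  have hμ'' : μ' ≤ (F.P J).m + (F.P J).K := hμ'J
  have h26 : ((3 ^ (F.P J).d - 1 : ℕ) : ℝ) = 26 := by rw [T3Family.P_d]; norm_num
  -- the output and input small factors
  have hsf₂ : ∀ l : LFLabel F K J, 0 ≤ (if l.1.val < K - J then smallFactor F.L γ b₀ p₀ a₂ (K - l.1.val) else 0) ∧
      (if l.1.val < K - J then smallFactor F.L γ b₀ p₀ a₂ (K - l.1.val) else 0) ≤ 1 := by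
    intro l
    split_ifs
    · refine ⟨(smallFactor_pos _ _ _ _ _ _).le, ?_⟩
      unfold smallFactor
      rw [Real.exp_le_one_iff]
      have : 0 ≤ a₂ * (B10.pFun b₀ p₀ (Real.sqrt (γ * ((F.L : ℝ)⁻¹) ^ (K - l.1.val)))) ^ 2 := by positivity
      linarith
    · exact ⟨le_rfl, zero_le_one⟩
  have hsf : ∀ l : LFLabel F K J, l.1.val < K - J →
      (if l.1.val < K - J then smallFactor F.L γ b₀ p₀ a₂ (K - l.1.val) else 0) * Real.exp 1 ≤
        (if l.1.val < K - J then smallFactor F.L γ b₀ p₀ (a₂ / 2) (K - l.1.val) else 0) := by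
    intro l hl
    rw [if_pos hl, if_pos hl]
    exact smallFactor_mul_exp_le_half hL1 hγ hγ1 hb hp1 ha₂ hlogγ _
  -- the two geometric rows on the `μ′`-blocks (FILE D)
  have hconn := fun (Fc Fc' : Finset (Site (F.P J) μ')) hc hc' hne => blocks_connected_union Fc Fc' hc hc' hne
  -- the door, instantiated at FILE 9's letters BY UNIFICATION; the rows one at a time (the entropy row through `convert`: its `Finset.filter`
  -- carries a different `Decidable` instance in ✓`sum_exp_neg_blocks_le_one` than in the door's statement)
  have key := engineRows_of_twoGas (fieldMeasure (F.P J) 0 (Matrix.specialUnitaryGroup (Fin 2) ℂ))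
    {U : GaugeField (F.P J) 0 (Matrix.specialUnitaryGroup (Fin 2) ℂ) | PlaqSmall (θBal F.L γ (c * b₀) p₀ J) U}
    (fun l : LFLabel F K J => (⟨siteShift (F.sitesPerDir_eq (m := F.m) (K := K) (j := l.1.val + (K - J - l.1.val)) (m' := F.m) (K' := J) (j' := 0)
              (by have := l.1.isLt; omega)) (blkIter (K - J - l.1.val) l.2.src), l.2.μ⟩ : PBond (F.P J) 0))
    (fun l : LFLabel F K J => l.1.val < K - J) (fun b : PBond (F.P J) 0 => iterBlockOf μ' b.src)
    (fun Fc : Finset (Site (F.P J) μ') => ((touchingGraph (SiteTouch (P := F.P J) (j := μ'))).induce (Fc : Set (Site (F.P J) μ'))).Connected)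
    (fun Q => heightDensity F γ hJK (histEvent F (θBal F.L γ b₀ p₀) K J Q))
    (heightDensity F γ hJK (histGood F ℰp (θBal F.L γ b₀ p₀) K J))
    (fun l : LFLabel F K J => if l.1.val < K - J then smallFactor F.L γ b₀ p₀ (a₂ / 2) (K - l.1.val) else 0)
    (fun l : LFLabel F K J => if l.1.val < K - J then smallFactor F.L γ b₀ p₀ a₂ (K - l.1.val) else 0)
    (τ := τ) (κ' := κ') (κh := κh) (κe := 2 + 2 * Real.log 26) Λ v h₂ ?g1 ?g2 ?g3 ?g4 ?g5 ?g6 ?g7 ?g8 ?g9 ?g10 ?g11 ?g12 ?g13 ?g14 ?g15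
  case g1 => exact hΛ
  case g2 => exact hconn
  case g3 => exact hvloc
  case g4 => exact hvc
  case g5 => exact hKP
  case g6 => exact hhloc
  case g7 => exact hhc
  case g8 => exact hhbd
  case g9 =>
    intro b
    convert sum_exp_neg_blocks_le_one hd hμ'' (κe := 2 + 2 * Real.log 26) (by rw [h26]) b using 3
  case g10 => exact hκ'
  case g11 => exact hτ
  case g12 => exact hκh
  case g13 => exact hsf₂
  case g14 => exact hsf
  case g15 => exact h2g
  obtain ⟨Adm, ζ, ζbar, κmu, r1, r2, r3, r4, r5, r6, r7, r8⟩ := key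
  exact ⟨Adm, ζ, ζbar, κmu, r1, r2, r3, r4, r5, r6, r7, r8⟩

/-! ## §3 The registered stub from the two-gas package -/

open Classical in
/-- ★★★ **THE REGISTERED `LargeFieldFourPtIntCan` (registry v11.4 :588, δ-unfolded, FILE 10's conclusion) FROM THE TWO-GAS PACKAGE**:
`largeFieldFourPtIntCan_of_enginePackage ∘ enginePackage_of_twoGasPackage`.  So `stub_largeFieldFourPtIntCan := largeFieldFourPtIntCan_of_twoGasPackage h2P` for any proof
`h2P` — the large-field half of [Balaban1985UV3] Thm 1 at this stub rests on the ONE-STEP∕MULTI-STEP EXPANSION WITH VACUUM POLYMERS AND HOLES (identity form + KP∕hole bounds), nothing after it.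
[cite: Balaban1985UV3, Thm 1 p.257 and (43)-(47) pp.266-267; Balaban1989LargeFieldII, (1.90)-(1.91) p.388 and (1.97)-(1.101) pp.389-390] -/
theorem largeFieldFourPtIntCan_of_twoGasPackage
    (h2P : ∀ (L : ℕ), ∃ μ : ℕ, ∃ a₂ : ℝ, 0 < a₂ ∧ ∃ c₀ : ℝ, 0 < c₀ ∧ c₀ ≤ 1 ∧ ∀ (c : ℝ), 0 < c → c ≤ c₀ → ∃ pS : ℝ, ∀ (b₀ p₀ : ℝ), 0 < b₀ → pS ≤ p₀ → 0 < p₀ →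
      ∃ γE : ℝ, 0 < γE ∧ ∀ (F : T3Family) (γ : ℝ), F.L = L → 0 < γ → γ ≤ γE →
        ∀ (J K : ℕ) (hJK : J ≤ K),
          {U : GaugeField (F.P J) 0 (Matrix.specialUnitaryGroup (Fin 2) ℂ) | PlaqSmall (θBal F.L γ (c * b₀) p₀ J) U} ⊆
            Node00.regSet (fieldMeasure (F.P J) 0 (Matrix.specialUnitaryGroup (Fin 2) ℂ)) (heightDensity F γ hJK Set.univ) →
          (∀ U : GaugeField (F.P J) 0 (Matrix.specialUnitaryGroup (Fin 2) ℂ), PlaqSmall (θBal F.L γ (c * b₀) p₀ J) U →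
              0 < heightDensityCan F γ hJK Set.univ U) →
          (∀ U : GaugeField (F.P J) 0 (Matrix.specialUnitaryGroup (Fin 2) ℂ), PlaqSmall (θBal F.L γ (c * b₀) p₀ J) U →
              0 < heightDensityCan F γ hJK (histGood F ℰp (θBal F.L γ b₀ p₀) K J) U) →
          -- ═══ the two-gas expansion at `(J, K)`: a grain, a vacuum gas, hole activities, and the UNNORMALISED identity ═══
          ∃ μ' : ℕ, μ' ≤ μ ∧ μ' ≤ F.m + J ∧
          ∃ (Λ : Finset (Finset (PBond (F.P J) 0))) (v : GaugeField (F.P J) 0 (Matrix.specialUnitaryGroup (Fin 2) ℂ) → Finset (PBond (F.P J) 0) → ℝ)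
            (h₂ : Finset (LFLabel F K J) → Finset (PBond (F.P J) 0) → GaugeField (F.P J) 0 (Matrix.specialUnitaryGroup (Fin 2) ℂ) → ℝ) (τ κ' κh : ℝ),
            -- the vacuum catalogue: non-empty footprints of touching-connected families of `μ′`-blocks
            (∀ X ∈ Λ, X.Nonempty ∧ ∃ Fc : Finset (Site (F.P J) μ'), ((touchingGraph (SiteTouch (P := F.P J) (j := μ'))).induce (Fc : Set (Site (F.P J) μ'))).Connected ∧
              Fc.biUnion (fun y => Finset.univ.filter (fun b : PBond (F.P J) 0 => iterBlockOf μ' b.src = y)) = X) ∧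
            -- vacuum activities: V-local, continuous on the window, Kotecký–Preiss (1) with size `τ·#blocks` and decay `κ′·#blocks`
            (∀ (X : Finset (PBond (F.P J) 0)) (U U' : GaugeField (F.P J) 0 (Matrix.specialUnitaryGroup (Fin 2) ℂ)), (∀ e ∈ X, U e = U' e) → v U X = v U' X) ∧
            (∀ X : Finset (PBond (F.P J) 0), ContinuousOn (fun U => v U X) {U : GaugeField (F.P J) 0 (Matrix.specialUnitaryGroup (Fin 2) ℂ) | PlaqSmall (θBal F.L γ (c * b₀) p₀ J) U}) ∧
            (∀ U ∈ {U : GaugeField (F.P J) 0 (Matrix.specialUnitaryGroup (Fin 2) ℂ) | PlaqSmall (θBal F.L γ (c * b₀) p₀ J) U},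
              ∀ σ : Finset (PBond (F.P J) 0), ∑ γ' ∈ Finset.univ.filter (fun γ' : Finset (PBond (F.P J) 0) => polyInc γ' σ),
                |v U γ'| * Real.exp (τ * (((γ'.image (fun b : PBond (F.P J) 0 => iterBlockOf μ' b.src)).card : ℕ) : ℝ) +
                  κ' * (((γ'.image (fun b : PBond (F.P J) 0 => iterBlockOf μ' b.src)).card : ℕ) : ℝ)) ≤
                τ * (((σ.image (fun b : PBond (F.P J) 0 => iterBlockOf μ' b.src)).card : ℕ) : ℝ)) ∧
            -- hole activities: V-local, continuous on the window, one small factor per deep hole and block decay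
            (∀ (Q' : Finset (LFLabel F K J)) (X : Finset (PBond (F.P J) 0)) (U U' : GaugeField (F.P J) 0 (Matrix.specialUnitaryGroup (Fin 2) ℂ)),
              (∀ e ∈ X, U e = U' e) → h₂ Q' X U = h₂ Q' X U') ∧
            (∀ (Q' : Finset (LFLabel F K J)) (X : Finset (PBond (F.P J) 0)), ContinuousOn (fun U => h₂ Q' X U) {U : GaugeField (F.P J) 0 (Matrix.specialUnitaryGroup (Fin 2) ℂ) | PlaqSmall (θBal F.L γ (c * b₀) p₀ J) U}) ∧
            (∀ (Q' : Finset (LFLabel F K J)) (X : Finset (PBond (F.P J) 0)) (U : GaugeField (F.P J) 0 (Matrix.specialUnitaryGroup (Fin 2) ℂ)), U ∈ {U : GaugeField (F.P J) 0 (Matrix.specialUnitaryGroup (Fin 2) ℂ) | PlaqSmall (θBal F.L γ (c * b₀) p₀ J) U} →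
              (∀ l ∈ Q', l.1.val < K - J) →
              |h₂ Q' X U| ≤ (∏ l ∈ Q', (if l.1.val < K - J then smallFactor F.L γ b₀ p₀ a₂ (K - l.1.val) else 0)) *
                Real.exp (-(κh * (((X.image (fun b : PBond (F.P J) 0 => iterBlockOf μ' b.src)).card : ℕ) : ℝ)))) ∧
            -- numeric rows: tree decay per block beats the entropy of block animals; the hole decay pays for the attached clusters
            4 + 2 * Real.log 26 ≤ κ' ∧ 0 < τ ∧ κ' + Real.exp (τ / κ') * τ + (2 + 2 * Real.log 26) ≤ κh ∧
            -- THE UNNORMALISED IDENTITY per deep history, a.e. on the window: `ρ(E_Q)·Ξ_v(Λ) = ρ(E_∅)·Σ_S (Π h₂)·Ξ_v(vacCompat Λ S)`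
            (∀ Q : Finset (LFLabel F K J), (∀ l ∈ Q, l.1.val < K - J) →
              ∀ᵐ U ∂fieldMeasure (F.P J) 0 (Matrix.specialUnitaryGroup (Fin 2) ℂ), U ∈ {U : GaugeField (F.P J) 0 (Matrix.specialUnitaryGroup (Fin 2) ℂ) | PlaqSmall (θBal F.L γ (c * b₀) p₀ J) U} →
                (heightDensity F γ hJK (histEvent F (θBal F.L γ b₀ p₀) K J Q) U : ℂ) *
                    polymerPartitionFunction polyInc (fun X => ((v U X : ℝ) : ℂ)) Λ =
                  (heightDensity F γ hJK (histGood F ℰp (θBal F.L γ b₀ p₀) K J) U : ℂ) *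
                    ∑ S ∈ (Finset.univ : Finset (Finset (PBond (F.P J) 0))).powerset.filter
                        (IsHoleFamily (fun X => (∃ l ∈ Q, (⟨siteShift (F.sitesPerDir_eq (m := F.m) (K := K) (j := l.1.val + (K - J - l.1.val)) (m' := F.m) (K' := J) (j' := 0)
              (by have := l.1.isLt; omega)) (blkIter (K - J - l.1.val) l.2.src), l.2.μ⟩ : PBond (F.P J) 0) ∈ X) ∧
                          ∃ Fc : Finset (Site (F.P J) μ'), ((touchingGraph (SiteTouch (P := F.P J) (j := μ'))).induce (Fc : Set (Site (F.P J) μ'))).Connected ∧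
                            Fc.biUnion (fun y => Finset.univ.filter (fun b : PBond (F.P J) 0 => iterBlockOf μ' b.src = y)) = X)
                          (Q.image fun l => (⟨siteShift (F.sitesPerDir_eq (m := F.m) (K := K) (j := l.1.val + (K - J - l.1.val)) (m' := F.m) (K' := J) (j' := 0)
              (by have := l.1.isLt; omega)) (blkIter (K - J - l.1.val) l.2.src), l.2.μ⟩ : PBond (F.P J) 0))),
                      (∏ X ∈ S, ((h₂ (Q.filter fun l => (⟨siteShift (F.sitesPerDir_eq (m := F.m) (K := K) (j := l.1.val + (K - J - l.1.val)) (m' := F.m) (K' := J) (j' := 0)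
              (by have := l.1.isLt; omega)) (blkIter (K - J - l.1.val) l.2.src), l.2.μ⟩ : PBond (F.P J) 0) ∈ X) X U : ℝ) : ℂ)) *
                        polymerPartitionFunction polyInc (fun X => ((v U X : ℝ) : ℂ)) (vacCompat Λ S))) :
    ∀ (L : ℕ), ∃ c₀ : ℝ, 0 < c₀ ∧ c₀ ≤ 1 ∧ ∀ (c : ℝ), 0 < c → c ≤ c₀ → ∃ pS : ℝ, ∀ (b₀ p₀ : ℝ), 0 < b₀ → pS ≤ p₀ → 0 < p₀ →
      ∃ γ₁ : ℝ, 0 < γ₁ ∧ ∃ κ : ℝ, 0 < κ ∧ ∀ (F : T3Family) (γ : ℝ), F.L = L → 0 < γ → γ ≤ γ₁ →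
        ∃ ψ : ℕ → ℝ, (∀ J, 0 ≤ ψ J) ∧ Tendsto (fun J : ℕ => (J : ℝ) * ψ J) atTop (𝓝 0) ∧
          ∀ (ν : ℕ → (j : ℕ) → Measure (GaugeField (F.P j) 0 (Matrix.specialUnitaryGroup (Fin 2) ℂ))),
            (∀ K, ν K K = T4GenFunBounds.gibbsMeasure (F.P K) ((F.scheme ℰp γ).β K)) →
            (∀ K j, j < K → ν K j = Measure.map (descend F ℰp j) (ν K (j + 1))) →
            ∀ (J K : ℕ) (hJK : J ≤ K) (ρ : GaugeField (F.P J) 0 (Matrix.specialUnitaryGroup (Fin 2) ℂ) → ℝ),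
              (∀ U, PlaqSmall (θBal F.L γ (c * b₀) p₀ J) U → 0 < ρ U) →
              ν K J = (fieldMeasure _ _ _).withDensity (fun U => ENNReal.ofReal (ρ U)) →
              ContinuousOn ρ {U | PlaqSmall (θBal F.L γ (c * b₀) p₀ J) U} →
              (∀ U : GaugeField (F.P J) 0 (Matrix.specialUnitaryGroup (Fin 2) ℂ), PlaqSmall (θBal F.L γ (c * b₀) p₀ J) U →
                  0 < heightDensityCan F γ hJK (histGood F ℰp (θBal F.L γ b₀ p₀) K J) U) →
              ∀ (b b' : PBond (F.P J) 0) (U V W Z : GaugeField (F.P J) 0 (Matrix.specialUnitaryGroup (Fin 2) ℂ)),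
                PlaqSmall (θBal F.L γ (c * b₀) p₀ J) U → PlaqSmall (θBal F.L γ (c * b₀) p₀ J) V →
                PlaqSmall (θBal F.L γ (c * b₀) p₀ J) W → PlaqSmall (θBal F.L γ (c * b₀) p₀ J) Z →
                (∀ e, e ≠ b → U e = V e) → (∀ e, e ≠ b' → U e = W e) → (∀ e, e ≠ b' → V e = Z e) → (∀ e, e ≠ b → W e = Z e) →
                |((fun U => Real.log (ρ U) - Real.log (heightDensityCan F γ hJK (histGood F ℰp (θBal F.L γ b₀ p₀) K J) U)) U -
                    (fun U => Real.log (ρ U) - Real.log (heightDensityCan F γ hJK (histGood F ℰp (θBal F.L γ b₀ p₀) K J) U)) V) -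
                  ((fun U => Real.log (ρ U) - Real.log (heightDensityCan F γ hJK (histGood F ℰp (θBal F.L γ b₀ p₀) K J) U)) W -
                    (fun U => Real.log (ρ U) - Real.log (heightDensityCan F γ hJK (histGood F ℰp (θBal F.L γ b₀ p₀) K J) U)) Z)|
                  ≤ ψ J * Real.exp (-(κ * (b.src.tdist b'.src : ℝ))) :=
  largeFieldFourPtIntCan_of_enginePackage (enginePackage_of_twoGasPackage h2P)

end Summit.QuantumFields.YangMills.Theorems.FluctuationComparisonRegPrIntLLargeFieldGasOfTwoGasPackage

end
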